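import Mathlib
import HarnessLib
import Literature.NumberTheory.Transcendental.KZCalculus
import Literature.NumberTheory.Transcendental.KZHomotopyMoves
import Literature.ModelTheory.ExponentialFields.SemialgebraicInterior
import Literature.NumberTheory.Transcendental.SemialgebraicMapsProofs
import Summits.KontsevichZagierPeriods.KontsevichZagierPeriods.Theorems.RootDecompWalshStrataWalshSpanCells

/-!
# The cone specimen, part 1/3: Walsh cells, the three cells, the homothety chart

Route `RootDecompWalshStrata` (cell decomp-kz, lens 4), support toward `QuadricSignKernel` (item
stmt-KontsevichZagierPeriods-25393) and its moves-only leaf `QuadricBakerDescent` (lens file WalshStrata.lean v3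
§QuadricRung): the first instance of the quadric descent `d = 3 → 2 → 1` decided INSIDE the Kontsevich–Zagier
rules. This part: weighted / polynomial-weighted Walsh cells, rule (1b) for polynomial weights, the cone /
quarter-cylinder / quarter-disc cells, and the change of variables `Φ(u,v,z) = (zu, zv, z)` (Jacobian `z²`)
with the relation `[cyl, z²] − [cone, 1] ∈ KZ.relations`. Imports: Literature + the landed `RootDecompWalshStrataWalshSpanCells` (Walsh cells `cellRep`, by name); 0 sorry.
[KontsevichZagier2001 §1.1–1.2]
-/

noncomputable section

open Literature.NumberTheory.Transcendental
open MeasureTheory Set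
open MvPolynomial (aeval X C)
open Literature.ModelTheory.ExponentialFields (IsSemialgebraic isSemialgebraic_setOf_eval_pos
  isSemialgebraic_setOf_eval_lt continuous_aeval_real)
open Summit.KontsevichZagierPeriods.RootDecompWalshStrata.WalshSpanProof (isSemialgebraic_cubeSet
  isBounded_cubeSet cellRep cellRep_domain cellRep_integrand)

namespace Summit.KontsevichZagierPeriods.RootDecompWalshStrata.ConeSpecimen

/-! ### The cone specimen (gen 3): `3·[(0,1)³ ∩ {z² > x² + y²}] ≡ [(0,1)² ∩ {1 > x² + y²}]`

First kernel-checked instance of the DESCENT of a quadric 3-cell to dimension 2 inside the rules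
(fibrewise homothety chart `(u,v,z) ↦ (zu, zv, z)` with Jacobian `z²`, rule (1b), rule (3) with the
polynomial primitives `z³` and `z`, and the null top/bottom faces) — no square root, no
transcendence. Values: `3 · π/12 = π/4`. -/

/-! #### Polynomial-weighted Walsh cells -/

/-- A Walsh cell lies in the closed unit cube. [folklore] -/
theorem cubeCell_subset_Icc {N : ℕ} (g : MvPolynomial (Fin N) ℚ) :
    {x : Fin N → ℝ | (∀ j, 0 < x j ∧ x j < 1) ∧ 0 < aeval x g} ⊆ Icc 0 1 := fun _ hx =>
  ⟨fun j => (hx.1 j).1.le, fun j => (hx.1 j).2.le⟩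

/-- A Walsh cell with a POLYNOMIAL weight: domain `(0,1)^N ∩ {g > 0}`, integrand `x ↦ h(x)`
(absolutely integrable: a polynomial on a bounded set). [KontsevichZagier2001 §1.1] -/
def polyRep {N : ℕ} (g h : MvPolynomial (Fin N) ℚ) : KZ.IntegralRep N where
  domain := {x | (∀ j, 0 < x j ∧ x j < 1) ∧ 0 < aeval x g}
  integrand x := aeval x h
  isSemialgebraic_domain := (isSemialgebraic_cubeSet N).inter (isSemialgebraic_setOf_eval_pos g)
  isSemialgebraicFunOn_integrand :=
    isSemialgebraicFunOn_aeval
      ((isSemialgebraic_cubeSet N).inter (isSemialgebraic_setOf_eval_pos g)) h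
  integrableOn :=
    ((continuous_aeval_real h).continuousOn.integrableOn_compact isCompact_Icc).mono_set
      (cubeCell_subset_Icc g)

/-- The domain of a polynomial-weighted Walsh cell (definitional unfolding). [definition] -/
@[simp] theorem polyRep_domain {N : ℕ} (g h : MvPolynomial (Fin N) ℚ) :
    (polyRep g h).domain = {x | (∀ j, 0 < x j ∧ x j < 1) ∧ 0 < aeval x g} := rfl

/-- The integrand of a polynomial-weighted Walsh cell is the polynomial. [definition] -/
@[simp] theorem polyRep_integrand {N : ℕ} (g h : MvPolynomial (Fin N) ℚ) (x : Fin N → ℝ) :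
    (polyRep g h).integrand x = aeval x h := rfl

/-- Rule (1b) for polynomial weights: `[σ, h₁ + h₂] − [σ, h₁] − [σ, h₂]` is a relation.
[KontsevichZagier2001 §1.2 rule (1)] -/
theorem of_polyRep_add_sub_mem_relations {N : ℕ} (g h₁ h₂ : MvPolynomial (Fin N) ℚ) :
    KZ.of (polyRep g (h₁ + h₂)) - KZ.of (polyRep g h₁) - KZ.of (polyRep g h₂) ∈ KZ.relations :=
  KZ.integrandAddRel_subset_relations ⟨N, polyRep g (h₁ + h₂), polyRep g h₁, polyRep g h₂, rfl, rfl,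
    fun x _ => by simp, rfl⟩

/-- `[σ, h + h + h] ≡ 3 · [σ, h]`. [KontsevichZagier2001 §1.2 rule (1)] -/
theorem of_polyRep_three_sub_mem_relations {N : ℕ} (g h : MvPolynomial (Fin N) ℚ) :
    KZ.of (polyRep g (h + h + h)) - 3 • KZ.of (polyRep g h) ∈ KZ.relations := by
  have h1 := of_polyRep_add_sub_mem_relations g (h + h) h
  have h2 := of_polyRep_add_sub_mem_relations g h h
  have : KZ.of (polyRep g (h + h + h)) - 3 • KZ.of (polyRep g h) =
      (KZ.of (polyRep g (h + h + h)) - KZ.of (polyRep g (h + h)) - KZ.of (polyRep g h)) +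
        (KZ.of (polyRep g (h + h)) - KZ.of (polyRep g h) - KZ.of (polyRep g h)) := by abel
  rw [this]
  exact add_mem h1 h2

/-- A constant weight is a polynomial weight: `[σ, w] ≡ [σ, C w]`. [definition] -/
theorem of_cellRep_sub_of_polyRep_C_mem_relations {N : ℕ} (g : MvPolynomial (Fin N) ℚ) (w : ℚ) :
    KZ.of (cellRep g w) - KZ.of (polyRep g (C w)) ∈ KZ.relations :=
  KZ.of_sub_of_mem_relations_of_eqOn rfl fun x _ => by
    simp only [cellRep_integrand, polyRep_integrand, MvPolynomial.aeval_C, eq_ratCast]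

/-! #### The three cells: cone, cylinder, quarter disc -/

/-- `z² − x² − y²` (the cone `x² + y² < z²` inside `(0,1)³`). -/
def conePoly : MvPolynomial (Fin 3) ℚ := X 2 ^ 2 - X 0 ^ 2 - X 1 ^ 2

/-- `1 − x² − y²` in three variables (the quarter cylinder inside `(0,1)³`). -/
def cylPoly : MvPolynomial (Fin 3) ℚ := 1 - X 0 ^ 2 - X 1 ^ 2

/-- `1 − x² − y²` in two variables (the quarter disc inside `(0,1)²`). -/
def discPoly : MvPolynomial (Fin 2) ℚ := 1 - X 0 ^ 2 - X 1 ^ 2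

/-- Evaluation of the cone polynomial `z² − x² − y²`. [definition] -/
@[simp] theorem aeval_conePoly (x : Fin 3 → ℝ) :
    aeval x conePoly = x 2 ^ 2 - x 0 ^ 2 - x 1 ^ 2 := by simp [conePoly]

/-- Evaluation of the cylinder polynomial `1 − x² − y²` (three variables). [definition] -/
@[simp] theorem aeval_cylPoly (x : Fin 3 → ℝ) : aeval x cylPoly = 1 - x 0 ^ 2 - x 1 ^ 2 := by
  simp [cylPoly]

/-- Evaluation of the disc polynomial `1 − x² − y²` (two variables). [definition] -/
@[simp] theorem aeval_discPoly (u : Fin 2 → ℝ) : aeval u discPoly = 1 - u 0 ^ 2 - u 1 ^ 2 := by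
  simp [discPoly]

/-- The quarter-disc base `(0,1)² ∩ {x² + y² < 1}`. -/
def discBase : Set (Fin 2 → ℝ) := {u | (∀ j, 0 < u j ∧ u j < 1) ∧ 0 < aeval u discPoly}

/-- The quarter disc is `ℚ`-semialgebraic. [BCR1998 §2.1] -/
theorem isSemialgebraic_discBase : IsSemialgebraic ℚ discBase :=
  (cellRep discPoly 1).isSemialgebraic_domain

/-- The open quarter cylinder is the open band over the quarter disc. [folklore] -/
theorem mem_cyl_iff_init (z : Fin 3 → ℝ) :
    z ∈ {w : Fin 3 → ℝ | (∀ j, 0 < w j ∧ w j < 1) ∧ 0 < aeval w cylPoly} ↔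
      Fin.init z ∈ discBase ∧ 0 < z (Fin.last 2) ∧ z (Fin.last 2) < 1 := by
  simp only [mem_setOf_eq, discBase, aeval_cylPoly, aeval_discPoly, Fin.init]
  constructor
  · rintro ⟨hw, hg⟩
    exact ⟨⟨fun j => hw (Fin.castSucc j), by simpa using hg⟩, (hw 2).1, (hw 2).2⟩
  · rintro ⟨⟨hu, hg⟩, h0, h1⟩
    refine ⟨fun j => ?_, by simpa using hg⟩
    fin_cases j
    · exact hu 0
    · exact hu 1
    · exact ⟨h0, h1⟩

/-- The closed band over the quarter disc lies in the closed unit cube. [folklore] -/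
theorem band_discBase_subset_Icc :
    KZlog.band discBase (fun _ => (0:ℝ)) (fun _ => 1) ⊆ Icc 0 1 := by
  intro z hz
  rw [KZlog.mem_band] at hz
  obtain ⟨⟨hu, _⟩, h0, h1⟩ := hz
  simp only [Fin.init] at hu
  refine ⟨fun j => ?_, fun j => ?_⟩
  · fin_cases j
    · exact (hu 0).1.le
    · exact (hu 1).1.le
    · exact h0
  · fin_cases j
    · exact (hu 0).2.le
    · exact (hu 1).2.le
    · exact h1

/-! #### The fibrewise homothety chart `Φ(u, v, z) = (z u, z v, z)` -/

/-- The chart as a polynomial map. -/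
def conePhiPoly : Fin 3 → MvPolynomial (Fin 3) ℚ := ![X 2 * X 0, X 2 * X 1, X 2]

/-- `Φ(u, v, z) = (z u, z v, z)`. -/
def conePhi : (Fin 3 → ℝ) → (Fin 3 → ℝ) := fun w j => aeval w (conePhiPoly j)

/-- First component of the chart: `Φ(w)₀ = w₂ w₀`. [definition] -/
@[simp] theorem conePhi_zero (w : Fin 3 → ℝ) : conePhi w 0 = w 2 * w 0 := by
  simp [conePhi, conePhiPoly]

/-- Second component of the chart: `Φ(w)₁ = w₂ w₁`. [definition] -/
@[simp] theorem conePhi_one (w : Fin 3 → ℝ) : conePhi w 1 = w 2 * w 1 := by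
  simp [conePhi, conePhiPoly]

/-- Third component of the chart: `Φ(w)₂ = w₂`. [definition] -/
@[simp] theorem conePhi_two (w : Fin 3 → ℝ) : conePhi w 2 = w 2 := by
  simp [conePhi, conePhiPoly]

/-- The Jacobian matrix of `Φ` at `w`. -/
def coneMat (w : Fin 3 → ℝ) : Matrix (Fin 3) (Fin 3) ℝ := !![w 2, 0, w 0; 0, w 2, w 1; 0, 0, 1]

/-- The derivative of `Φ` at `w` as a continuous linear map. -/
def conePhi' (w : Fin 3 → ℝ) : (Fin 3 → ℝ) →L[ℝ] (Fin 3 → ℝ) :=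
  LinearMap.toContinuousLinearMap (Matrix.toLin' (coneMat w))

/-- The derivative `Φ'(w)` acts by the Jacobian matrix. [calculus] -/
theorem conePhi'_apply (w v : Fin 3 → ℝ) (a : Fin 3) :
    conePhi' w v a = ∑ b, coneMat w a b * v b := by
  change Matrix.toLin' (coneMat w) v a = _
  rw [Matrix.toLin'_apply]
  rfl

/-- `det Φ'(u, v, z) = z²`. -/
theorem conePhi'_det (w : Fin 3 → ℝ) : (conePhi' w).det = w 2 ^ 2 := by
  change LinearMap.det (Matrix.toLin' (coneMat w)) = _
  rw [LinearMap.det_toLin', Matrix.det_fin_three]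
  simp [coneMat]
  ring

/-- `Φ` is differentiable with derivative `Φ'`. -/
theorem hasFDerivAt_conePhi (w : Fin 3 → ℝ) : HasFDerivAt conePhi (conePhi' w) w := by
  have h0 : HasFDerivAt (fun y : Fin 3 → ℝ => conePhi y 0)
      ((ContinuousLinearMap.proj 0).comp (conePhi' w)) w := by
    have hf : (fun y : Fin 3 → ℝ => conePhi y 0) = fun y => y 2 * y 0 := funext conePhi_zero
    rw [hf]
    refine ((hasFDerivAt_apply 2 w).mul (hasFDerivAt_apply 0 w)).congr_fderiv
      (ContinuousLinearMap.ext fun v => ?_)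
    simp [conePhi'_apply, coneMat, Fin.sum_univ_three]
  have h1 : HasFDerivAt (fun y : Fin 3 → ℝ => conePhi y 1)
      ((ContinuousLinearMap.proj 1).comp (conePhi' w)) w := by
    have hf : (fun y : Fin 3 → ℝ => conePhi y 1) = fun y => y 2 * y 1 := funext conePhi_one
    rw [hf]
    refine ((hasFDerivAt_apply 2 w).mul (hasFDerivAt_apply 1 w)).congr_fderiv
      (ContinuousLinearMap.ext fun v => ?_)
    simp [conePhi'_apply, coneMat, Fin.sum_univ_three]
  have h2 : HasFDerivAt (fun y : Fin 3 → ℝ => conePhi y 2)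
      ((ContinuousLinearMap.proj 2).comp (conePhi' w)) w := by
    have hf : (fun y : Fin 3 → ℝ => conePhi y 2) = fun y => y 2 := funext conePhi_two
    rw [hf]
    refine (hasFDerivAt_apply 2 w).congr_fderiv (ContinuousLinearMap.ext fun v => ?_)
    simp [conePhi'_apply, coneMat, Fin.sum_univ_three]
  refine hasFDerivAt_pi'' fun a => ?_
  fin_cases a
  · exact h0
  · exact h1
  · exact h2

/-- `Φ` is injective where `z > 0`. -/
theorem injOn_conePhi : InjOn conePhi {w | 0 < w 2} := by
  intro x _ y hy hxy
  have h2 : x 2 = y 2 := by simpa using congrFun hxy 2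
  have h0 : x 0 = y 0 := by
    have h := congrFun hxy 0
    simp only [conePhi_zero, h2] at h
    exact mul_left_cancel₀ (ne_of_gt hy) h
  have h1 : x 1 = y 1 := by
    have h := congrFun hxy 1
    simp only [conePhi_one, h2] at h
    exact mul_left_cancel₀ (ne_of_gt hy) h
  funext a
  fin_cases a
  · exact h0
  · exact h1
  · exact h2

/-- `Φ` maps the open quarter cylinder onto the open cone `(0,1)³ ∩ {x² + y² < z²}`. -/
theorem image_conePhi :
    conePhi '' {w : Fin 3 → ℝ | (∀ j, 0 < w j ∧ w j < 1) ∧ 0 < aeval w cylPoly} =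
      {x | (∀ j, 0 < x j ∧ x j < 1) ∧ 0 < aeval x conePoly} := by
  ext x
  simp only [mem_image, mem_setOf_eq, aeval_cylPoly, aeval_conePoly]
  constructor
  · rintro ⟨w, ⟨hw, hg⟩, rfl⟩
    refine ⟨fun j => ?_, ?_⟩
    · fin_cases j
      · exact ⟨by simpa using mul_pos (hw 2).1 (hw 0).1,
          by simpa using mul_lt_one_of_nonneg_of_lt_one_left (hw 2).1.le (hw 2).2 (hw 0).2.le⟩
      · exact ⟨by simpa using mul_pos (hw 2).1 (hw 1).1,
          by simpa using mul_lt_one_of_nonneg_of_lt_one_left (hw 2).1.le (hw 2).2 (hw 1).2.le⟩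
      · simpa using hw 2
    · simp only [conePhi_zero, conePhi_one, conePhi_two]
      have : w 2 ^ 2 - (w 2 * w 0) ^ 2 - (w 2 * w 1) ^ 2 = w 2 ^ 2 * (1 - w 0 ^ 2 - w 1 ^ 2) := by
        ring
      rw [this]
      exact mul_pos (pow_pos (hw 2).1 2) hg
  · rintro ⟨hx, hg⟩
    have hx0 := hx 0
    have hx1 := hx 1
    have hx2 := hx 2
    have h02 : x 0 < x 2 := by nlinarith [sq_nonneg (x 1)]
    have h12 : x 1 < x 2 := by nlinarith [sq_nonneg (x 0)]
    refine ⟨![x 0 / x 2, x 1 / x 2, x 2], ⟨fun j => ?_, ?_⟩, ?_⟩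
    · fin_cases j
      · exact ⟨by simpa using div_pos hx0.1 hx2.1, by simpa using (div_lt_one hx2.1).2 h02⟩
      · exact ⟨by simpa using div_pos hx1.1 hx2.1, by simpa using (div_lt_one hx2.1).2 h12⟩
      · simpa using hx2
    · have hne : x 2 ≠ 0 := hx2.1.ne'
      have : (1 : ℝ) - (x 0 / x 2) ^ 2 - (x 1 / x 2) ^ 2 = (x 2 ^ 2 - x 0 ^ 2 - x 1 ^ 2) / x 2 ^ 2 := by
        field_simp
      simp only [Matrix.cons_val_zero, Matrix.cons_val_one]
      rw [this]
      exact div_pos hg (pow_pos hx2.1 2)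
    · have hne : x 2 ≠ 0 := hx2.1.ne'
      funext a
      fin_cases a
      · simp [mul_div_cancel₀ _ hne]
      · simp [mul_div_cancel₀ _ hne]
      · simp

/-! #### The six moves -/

/-- **Move (2):** `[cyl, z²] − [cone, 1]` is a change of variables along `Φ` (`|det Φ'| = z²`).
[KontsevichZagier2001 §1.2 rule (2)] -/
theorem of_cylSq_sub_of_cone_mem_relations :
    KZ.of (polyRep cylPoly (X 2 ^ 2)) - KZ.of (cellRep conePoly 1) ∈ KZ.relations := by
  refine KZ.changeOfVariablesRel_subset_relations
    ⟨3, polyRep cylPoly (X 2 ^ 2), cellRep conePoly 1, conePhi, conePhi', ?_,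
      fun w _ => (hasFDerivAt_conePhi w).hasFDerivWithinAt,
      injOn_conePhi.mono fun w hw => (hw.1 2).1, ?_, fun w _ => ?_, rfl⟩
  · exact isSemialgebraicMapOn_aeval (polyRep cylPoly (X 2 ^ 2)).isSemialgebraic_domain conePhiPoly
  · rw [cellRep_domain, polyRep_domain, image_conePhi]
  · rw [polyRep_integrand, cellRep_integrand, conePhi'_det, abs_of_nonneg (sq_nonneg _)]
    simp


end Summit.KontsevichZagierPeriods.RootDecompWalshStrata.ConeSpecimen

end
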